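/-
Copyright (c) 2026. All rights reserved.
Released under Apache 2.0 license as described in the file LICENSE.
Authors: abc-iut cell, F fact-proving wave seat abc-iut-f-073 (tranche 73, exact criterion for F-0319).
-/
import Literature.AnabelianGeometry.AbsoluteAnabelian.AbsTopIII.BiAnabelianIncompatibilityProofs
import Literature.AnabelianGeometry.AbsoluteAnabelian.AbsTopIII.MonoAnabelianComparisonPredicatesProofs

/-!
# [AbsTopIII] Cor 3.7 (iv), first incompatibility — NECESSITY of the kernel statement: a core
# structure compatible with `𝔖†_log` IS a natural `ζ : 𝟭 ⥲ log` with `λ^×(ζ) ≫ ι_log = ι_×`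

S. Mochizuki, *Topics in absolute anabelian geometry III* [MochizukiAbsTopIII2015] (kurims manuscript
`paper:url-5493eb38cbb7`; journal pagination not held), Cor 3.7 (iv) p. 88 ("`𝒟†_{≤2}` does not admit
a structure of core on `𝒟†_{≤1}` which [...] is compatible with [...] the observable `𝔖†_log`"), proof
"entirely similar to" the proof of Cor 3.6 (iv) p. 81: a compatible core structure yields a homotopy
`ζ₀` for `([pr_{⋎+1}], [pr_⋎]∘[log_𝒳])`, and `ζ'₁ = ζ₁ ∘ ζ'₀` "must coincide with the homotopy `ζ₂`" —
"writing out explicitly the meaning of such an equality", `λ^×(ζ₀) ≫ ι_log = ι_×`.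

PROOF-ONLY companion of `BiAnabelianIncompatibility.lean` / `BiAnabelianIncompatibilityProofs.lean`
(abc-iut-L4-t9) and of `MonoAnabelianComparisonPredicatesProofs.lean` (F-0388 `LogCoreKernel`): no
notion is declared.  It proves the first half of the EXACT CRITERION for the schema row F-0319
`IncompatibleStmt` (FACT-LIST tranche 73):

* `DiagramOfCategories.HomotopyFamily.core_compatible_eq_left` — the EQUATION behind abc-iut-L4-t10's
  `false_of_core_compatible_of_obstruction_left` (`AutHolLogFrobeniusIncompatibility.lean`), for an
  arbitrary family of homotopies on an arbitrary diagram of categories: if the family contains a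
  homotopy `ζ₀` for `([id₁], [id₀]∘[log])` (invertibility is NOT needed for the equation), the pair
  `([λ^×],[λ^{×pf}])` with components `ι_×` and the type-(1) pair with components `ι_log`, then at every
  object `x₀`, `λ^×(ζ₀(x₀)) ≫ ι_log(x₀) = ι_×(id₁ x₀)` (t10's proof, verbatim up to its last step, which
  there feeds a component-level obstruction; adapted, not re-exported, because t10 concludes `False`);
* `BiAnabelianSetting.logCoreKernel_of_coreFamily` — on `𝒟†_{≤3}` of ANY `𝔖 : BiAnabelianSetting X E N`,
  a family `K` containing isomorphisms `ζ₀` for the would-be core pairs `([pr_{⋎+1}], [pr_⋎]∘[log_𝒳])` and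
  the pinned `𝔖†_log` homotopies yields the kernel statement `LogCoreKernel` (F-0388): restricting `ζ₀`
  (at `⋎ = 0`) along the diagonal `δ_𝒳 : 𝒳 → 𝒳 ×_𝔈 𝒳` (`pr ∘ δ_𝒳 = id`, `pr ∘ log_𝒳 ∘ δ_𝒳 = log` on the
  nose) gives a natural ISOMORPHISM `ζ : 𝟭_𝒳 ⥲ log`, and the equation above at `x₀ = δ_𝒳(A)` is the
  kernel equation `λ^×(ζ_A) ≫ ι_{log,A} = ι_{×,A}`;
* `incompatibleStmt_of_not_logCoreKernel : ¬ 𝔖.LogCoreKernel → 𝔖.IncompatibleStmt` and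
  `logCoreKernel_of_not_incompatibleStmt` — so t9's reduction `incompatibleStmt_of_obstruction`
  (Lemma-3.4 obstruction ⇒ (iv)) factors through the WEAKER hypothesis `¬ LogCoreKernel`
  (`not_logCoreKernel_of_logKernelObstruction`); the converse (a lax shadow family realising a core
  compatible with `𝔖†_log` from any such `ζ`) is the sibling file `BiAnabelianIncompatibilityKernelFamily`.

HONEST FRAMING: statements about the cell's typing of refereed pre-IUT material over ABSTRACT data
(`BiAnabelianSetting`); for the MLF data both sides are the theorems already in the tree
(`TFModel.model_incompatibleStmt`, `TFModel.modelSetting_not_logCoreKernel`); nothing here bears on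
[IUTchIII] Cor. 3.12 or takes a side; typed ≠ proved.
-/

set_option autoImplicit false

namespace Literature.AnabelianGeometry.AbsoluteAnabelian

open _root_.CategoryTheory _root_.Quiver

universe u v' u' w' v₁ v₂ u₁ u₂

/-! ## The core-compatibility EQUATION for an arbitrary family of homotopies -/

namespace DiagramOfCategories.HomotopyFamily

/-- Components of a natural transformation at propositionally equal objects. [folklore] -/
private theorem app_eq_of_obj_eq {C : Type u₁} [Category.{v₁} C] {C' : Type u₂} [Category.{v₂} C']
    {F G : C ⥤ C'} (θ : F ⟶ G) {X Y : C} (h : X = Y) :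
    θ.app X = eqToHom (by rw [h]) ≫ θ.app Y ≫ eqToHom (by rw [h]) := by
  subst h
  simp

/-- Merging the `eqToHom`s of a singly nested conjugate. [folklore] -/
private theorem eqToHom_sandwich {C : Type u₁} [Category.{v₁} C] {A B₁ B₂ C₁ C₂ E : C} (p : A = B₁)
    (q : B₁ = B₂) (m : B₂ ⟶ C₁) (r : C₁ = C₂) (s : C₂ = E) :
    eqToHom p ≫ (eqToHom q ≫ m ≫ eqToHom r) ≫ eqToHom s =
      eqToHom (p.trans q) ≫ m ≫ eqToHom (r.trans s) := by
  cases p; cases q; cases r; cases s; simp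

/-- Merging the `eqToHom`s of a doubly nested conjugate. [folklore] -/
private theorem eqToHom_sandwich₂ {C : Type u₁} [Category.{v₁} C] {A B₁ B₂ B₃ C₁ C₂ C₃ E : C} (p : A = B₁)
    (q : B₁ = B₂) (q' : B₂ = B₃) (m : B₃ ⟶ C₁) (r : C₁ = C₂) (r' : C₂ = C₃) (s : C₃ = E) :
    eqToHom p ≫ (eqToHom q ≫ (eqToHom q' ≫ m ≫ eqToHom r) ≫ eqToHom r') ≫ eqToHom s =
      eqToHom (p.trans (q.trans q')) ≫ m ≫ eqToHom (r.trans (r'.trans s)) := by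
  cases p; cases q; cases q'; cases r; cases r'; cases s; simp

/-- Normalising lemma (left-hand side of the compatibility equation). [folklore] -/
private theorem eqToHom_sandwich_left {C : Type u₁} [Category.{v₁} C] {A S B C₁ C₂ T Y Y' : C}
    (a : A = S) (p : S = B) (m : B ⟶ C₁) (q : C₁ = C₂) (r : C₂ = T) (f : T ⟶ Y) (b : Y = Y')
    (b' : Y' = Y) :
    eqToHom a ≫ ((eqToHom p ≫ m ≫ eqToHom q) ≫ (eqToHom r ≫ f ≫ eqToHom b)) ≫ eqToHom b' =
      eqToHom (a.trans p) ≫ m ≫ eqToHom (q.trans r) ≫ f := by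
  cases a; cases p; cases q; cases r; cases b; simp

/-- Normalising lemma (right-hand side of the compatibility equation). [folklore] -/
private theorem eqToHom_sandwich_right {C : Type u₁} [Category.{v₁} C] {A S A' Y Y' : C}
    (a : A = S) (r : S = A') (g : A' ⟶ Y) (b : Y = Y') (b' : Y' = Y) :
    eqToHom a ≫ (eqToHom r ≫ g ≫ eqToHom b) ≫ eqToHom b' = eqToHom (a.trans r) ≫ g := by
  cases a; cases r; cases b; simp

/-- **The compatibility EQUATION of the proof of Cor 3.6 (iv) / 3.7 (iv)**, for an arbitrary family
of homotopies `K` on an arbitrary diagram of categories.  Five edges `log : v₁ → v₀`, `id₁ : v₁ → □`,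
`id₀ : v₀ → □`, `λ^×, λ^{×pf} : □ → 𝒩`; `ι_×` between the last two edge functors, `ι_log` between the
functors of `[λ^×]∘[id₀]∘[log]` and `[λ^{×pf}]∘[id₁]`.  If `K` contains a homotopy `ζ₀` for
`([id₁], [id₀]∘[log])` (NOT assumed invertible), the pair `([λ^×],[λ^{×pf}])` with components `ι_×` and
the type-(1) pair with components `ι_log`, then "`ζ'₁ = ζ₁ ∘ ζ'₀`" and `ζ₂` are homotopies of the SAME
pair `([λ^×]∘[id₁], [λ^{×pf}]∘[id₁])`, hence coincide (Def 3.5 (ii)): at every `x₀`,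
`λ^×(ζ₀(x₀)) ≫ ι_log(x₀) = ι_×(id₁ x₀)` — "writing out explicitly the meaning of such an equality
`ζ'₁ = ζ₂`".  Adapted from abc-iut-L4-t10's `false_of_core_compatible_of_obstruction_left` (same
computation; t10 feeds it to an obstruction and concludes `False`, here the equation is the output).
[cite: MochizukiAbsTopIII2015, Corollary 3.6 (iv) p.81] -/
theorem core_compatible_eq_left {V : Type w'} [Quiver.{v'} V]
    {D : DiagramOfCategories.{v', u', w'} V} (K : D.HomotopyFamily) {v1 v0 sq ob : V}
    (eLog : v1 ⟶ v0) (eId1 : v1 ⟶ sq) (eId0 : v0 ⟶ sq) (eT eP : sq ⟶ ob)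
    (ιt : D.map eT ⟶ D.map eP)
    (ιl : (D.map eLog ⋙ D.map eId0) ⋙ D.map eT ⟶ D.map eId1 ⋙ D.map eP)
    (h₀ : K.E ((Path.nil : Path v1 v1).cons eId1) (((Path.nil : Path v1 v1).cons eLog).cons eId0))
    (hT : K.E ((Path.nil : Path sq sq).cons eT) ((Path.nil : Path sq sq).cons eP))
    (hhT : ∀ (x : D.obj sq)
      (e₁ : (D.pathFunctor ((Path.nil : Path sq sq).cons eT)).obj x = (D.map eT).obj x)
      (e₂ : (D.pathFunctor ((Path.nil : Path sq sq).cons eP)).obj x = (D.map eP).obj x),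
      (K.η hT).app x = eqToHom e₁ ≫ ιt.app x ≫ eqToHom e₂.symm)
    (h₁ : K.E ((((Path.nil : Path v1 v1).cons eLog).cons eId0).cons eT)
      (((Path.nil : Path v1 v1).cons eId1).cons eP))
    (hh₁ : ∀ (x : D.obj v1)
      (e₁ : (D.pathFunctor ((((Path.nil : Path v1 v1).cons eLog).cons eId0).cons eT)).obj x =
        (D.map eT).obj ((D.map eId0).obj ((D.map eLog).obj x)))
      (e₂ : (D.pathFunctor (((Path.nil : Path v1 v1).cons eId1).cons eP)).obj x =
        (D.map eP).obj ((D.map eId1).obj x)),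
      (K.η h₁).app x = eqToHom e₁ ≫ ιl.app x ≫ eqToHom e₂.symm)
    (x₀ : D.obj v1)
    (a₁ : (D.map eId1).obj x₀ = (D.pathFunctor ((Path.nil : Path v1 v1).cons eId1)).obj x₀)
    (a₂ : (D.pathFunctor (((Path.nil : Path v1 v1).cons eLog).cons eId0)).obj x₀ =
      (D.map eId0).obj ((D.map eLog).obj x₀)) :
    (D.map eT).map (eqToHom a₁ ≫ (K.η h₀).app x₀ ≫ eqToHom a₂) ≫ ιl.app x₀ =
      ιt.app ((D.map eId1).obj x₀) := by
  -- adapted from reserve-free tree material: abc-iut-L4-t10, `false_of_core_compatible_of_obstruction_left`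
  have E0 : D.pathFunctor (Path.nil : Path v1 v1) = 𝟭 _ := DiagramOfCategories.pathFunctor_nil _ _
  have E0' : D.pathFunctor (Path.nil : Path ob ob) = 𝟭 _ := DiagramOfCategories.pathFunctor_nil _ _
  have ET : D.pathFunctor ((Path.nil : Path sq sq).cons eT) = D.map eT := by
    rw [DiagramOfCategories.pathFunctor_cons, DiagramOfCategories.pathFunctor_nil, Functor.id_comp]
  have EP : D.pathFunctor ((Path.nil : Path sq sq).cons eP) = D.map eP := by
    rw [DiagramOfCategories.pathFunctor_cons, DiagramOfCategories.pathFunctor_nil, Functor.id_comp]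
  have E1 : D.pathFunctor ((Path.nil : Path v1 v1).cons eId1) = D.map eId1 := by
    rw [DiagramOfCategories.pathFunctor_cons, DiagramOfCategories.pathFunctor_nil, Functor.id_comp]
  have E2 : D.pathFunctor (((Path.nil : Path v1 v1).cons eLog).cons eId0) = D.map eLog ⋙ D.map eId0 := by
    rw [DiagramOfCategories.pathFunctor_cons, DiagramOfCategories.pathFunctor_cons,
      DiagramOfCategories.pathFunctor_nil, Functor.id_comp]
  have E3 : D.pathFunctor (((Path.nil : Path v1 v1).cons eId1).cons eT) = D.map eId1 ⋙ D.map eT := by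
    rw [DiagramOfCategories.pathFunctor_cons, E1]
  have E4 : D.pathFunctor (((Path.nil : Path v1 v1).cons eId1).cons eP) = D.map eId1 ⋙ D.map eP := by
    rw [DiagramOfCategories.pathFunctor_cons, E1]
  have E5 : D.pathFunctor ((((Path.nil : Path v1 v1).cons eLog).cons eId0).cons eT) =
      (D.map eLog ⋙ D.map eId0) ⋙ D.map eT := by
    rw [DiagramOfCategories.pathFunctor_cons, E2]
  have s1 : K.E ((((Path.nil : Path v1 v1).cons eId1)).cons eT)
      ((((Path.nil : Path v1 v1).cons eLog).cons eId0).cons eT) :=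
    K.isSaturated.precomp (K.isSaturated.postcomp h₀ ((Path.nil : Path sq sq).cons eT)) Path.nil
  have s3 : K.E (((Path.nil : Path v1 v1).cons eId1).cons eT)
      (((Path.nil : Path v1 v1).cons eId1).cons eP) :=
    K.isSaturated.precomp (K.isSaturated.postcomp hT Path.nil) ((Path.nil : Path v1 v1).cons eId1)
  -- `ζ₁ ∘ ζ'₀` and `ζ₂` are homotopies of the same pair, hence equal
  have kapp : (K.η s1).app x₀ ≫ (K.η h₁).app x₀ = (K.η s3).app x₀ := by
    rw [← NatTrans.comp_app, ← K.η_trans s1 h₁]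
  have W1 : K.η s1 = eqToHom (by rw [E3, E0, E1, ET, Functor.id_comp]) ≫
      Functor.whiskerLeft (D.pathFunctor (Path.nil : Path v1 v1))
        (Functor.whiskerRight (K.η h₀) (D.pathFunctor ((Path.nil : Path sq sq).cons eT))) ≫
      eqToHom (by rw [E5, E0, E2, ET, Functor.id_comp]) :=
    K.η_whisker h₀ Path.nil ((Path.nil : Path sq sq).cons eT)
  have W3 : K.η s3 = eqToHom (by rw [E3, E1, ET, E0', Functor.comp_id]) ≫
      Functor.whiskerLeft (D.pathFunctor ((Path.nil : Path v1 v1).cons eId1))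
        (Functor.whiskerRight (K.η hT) (D.pathFunctor (Path.nil : Path ob ob))) ≫
      eqToHom (by rw [E4, E1, EP, E0', Functor.comp_id]) :=
    K.η_whisker hT ((Path.nil : Path v1 v1).cons eId1) Path.nil
  have hx0 : (D.pathFunctor (Path.nil : Path v1 v1)).obj x₀ = x₀ := Functor.congr_obj E0 x₀
  have hx1 : (D.pathFunctor ((Path.nil : Path v1 v1).cons eId1)).obj x₀ = (D.map eId1).obj x₀ :=
    Functor.congr_obj E1 x₀
  have o3 : (D.pathFunctor (((Path.nil : Path v1 v1).cons eId1).cons eT)).obj x₀ =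
      (D.map eT).obj ((D.map eId1).obj x₀) := Functor.congr_obj E3 x₀
  have M₁ : (D.pathFunctor (((Path.nil : Path v1 v1).cons eId1).cons eT)).obj x₀ =
      (D.map eT).obj ((D.pathFunctor ((Path.nil : Path v1 v1).cons eId1)).obj x₀) := by
    rw [E3, E1]; rfl
  have M₂ : (D.map eT).obj ((D.pathFunctor (((Path.nil : Path v1 v1).cons eLog).cons eId0)).obj x₀) =
      (D.pathFunctor ((((Path.nil : Path v1 v1).cons eLog).cons eId0).cons eT)).obj x₀ := by
    rw [E5, E2]; rfl
  have N₁ : (D.pathFunctor ((((Path.nil : Path v1 v1).cons eLog).cons eId0).cons eT)).obj x₀ =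
      (D.map eT).obj ((D.map eId0).obj ((D.map eLog).obj x₀)) := Functor.congr_obj E5 x₀
  have N₂ : (D.map eP).obj ((D.map eId1).obj x₀) =
      (D.pathFunctor (((Path.nil : Path v1 v1).cons eId1).cons eP)).obj x₀ := (Functor.congr_obj E4 x₀).symm
  have W1x := NatTrans.congr_app W1 x₀
  simp only [NatTrans.comp_app, eqToHom_app, Functor.whiskerLeft_app, Functor.whiskerRight_app,
    Functor.congr_hom ET, app_eq_of_obj_eq (K.η h₀) hx0, Functor.map_comp, eqToHom_map,
    Category.assoc, eqToHom_trans, eqToHom_trans_assoc] at W1x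
  have W1c : (K.η s1).app x₀ = eqToHom M₁ ≫ (D.map eT).map ((K.η h₀).app x₀) ≫ eqToHom M₂ :=
    W1x.trans (eqToHom_sandwich _ _ _ _ _)
  have W2c : (K.η h₁).app x₀ = eqToHom N₁ ≫
      (ιl.app x₀ : (D.map eT).obj ((D.map eId0).obj ((D.map eLog).obj x₀)) ⟶
        (D.map eP).obj ((D.map eId1).obj x₀)) ≫ eqToHom N₂ :=
    hh₁ x₀ N₁ N₂.symm
  have W3x := NatTrans.congr_app W3 x₀
  simp only [NatTrans.comp_app, eqToHom_app, Functor.whiskerLeft_app, Functor.whiskerRight_app,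
    Functor.congr_hom E0', Functor.id_map, app_eq_of_obj_eq (K.η hT) hx1,
    hhT ((D.map eId1).obj x₀) (Functor.congr_obj ET _) (Functor.congr_obj EP _),
    Category.assoc, eqToHom_trans, eqToHom_trans_assoc] at W3x
  have W3c : (K.η s3).app x₀ = eqToHom o3 ≫ ιt.app ((D.map eId1).obj x₀) ≫ eqToHom N₂ :=
    W3x.trans (eqToHom_sandwich₂ _ _ _ _ _ _ _)
  rw [W1c, W2c, W3c] at kapp
  have k5 := ((eqToHom_sandwich_left o3.symm M₁ _ M₂ N₁ _ N₂ N₂.symm).symm.trans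
    ((congrArg (fun t => eqToHom o3.symm ≫ t ≫ eqToHom N₂.symm) kapp).trans
      (eqToHom_sandwich_right o3.symm o3 _ N₂ N₂.symm)))
  simp only [eqToHom_refl, Category.id_comp] at k5
  simp only [Functor.map_comp, eqToHom_map, Category.assoc]
  exact k5

end DiagramOfCategories.HomotopyFamily

/-! ## A core structure compatible with `𝔖†_log` yields the kernel statement -/

namespace AbsTopIII

namespace BiAnabelianSetting

open DiagramOfCategories

variable {X E N : Type u} [Category.{u} X] [Category.{u} E] [Category.{u} N]
  (𝔖 : BiAnabelianSetting X E N)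

/-- `𝒟†_{[pr_{⋎+1}]} = pr` at `⋎ = 0` (path functor of the left path of the would-be core pair).
[cite: MochizukiAbsTopIII2015, Cor 3.7 (iv) p.88] -/
theorem pathFunctor_corePathPr_zero :
    𝔖.logObsDiagram.pathFunctor (corePathPr.{u} 0) = 𝔖.pr := by
  rw [pathFunctor_eq_pathFunctor']; rfl

/-- `𝒟†_{[pr_⋎]∘[log_𝒳]} = log_𝒳 ⋙ pr` at `⋎ = 0` (path functor of the right path of the would-be core
pair). [cite: MochizukiAbsTopIII2015, Cor 3.7 (iv) p.88] -/
theorem pathFunctor_corePathLog_zero :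
    𝔖.logObsDiagram.pathFunctor (corePathLog.{u} 0) = 𝔖.logSq ⋙ 𝔖.pr := by
  rw [pathFunctor_eq_pathFunctor']; rfl

/-- `δ_𝒳` followed by `𝒟†_{[pr_{⋎+1}]}` is the identity of `𝒳` (`pr ∘ δ_𝒳 = id` on the nose).
[cite: MochizukiAbsTopIII2015, Cor 3.7 (ii) p.88] -/
theorem diag_comp_pathFunctor_corePathPr_zero :
    𝟭 X = 𝔖.diag ⋙ 𝔖.logObsDiagram.pathFunctor (corePathPr.{u} 0) := by
  rw [pathFunctor_corePathPr_zero]; rfl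

/-- `δ_𝒳` followed by `𝒟†_{[pr_⋎]∘[log_𝒳]}` is `log` (`pr ∘ log_𝒳 ∘ δ_𝒳 = log` on the nose).
[cite: MochizukiAbsTopIII2015, Cor 3.7 (iv) p.88] -/
theorem diag_comp_pathFunctor_corePathLog_zero :
    𝔖.diag ⋙ 𝔖.logObsDiagram.pathFunctor (corePathLog.{u} 0) = 𝔖.log := by
  rw [pathFunctor_corePathLog_zero]; rfl

/-- **A structure of core on `𝒟†_{≤1}` compatible with `𝔖†_log` IS the kernel statement.**  If a family
of homotopies `K` on `𝒟†_{≤3}` contains, for every `⋎`, an ISOMORPHISM for the would-be core pair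
`([pr_{⋎+1}], [pr_⋎]∘[log_𝒳])` (the `ζ₀` of the proof of Cor 3.6 (iv) p. 81, read for Cor 3.7) together
with the pinned `𝔖†_log` homotopies (`LogPinned`), then `LogCoreKernel 𝔖` holds: the homotopy `ζ₀` at
`⋎ = 0` restricted along the diagonal `δ_𝒳` is a natural isomorphism `ζ : 𝟭_𝒳 ⥲ log`, and the
compatibility equation `core_compatible_eq_left` at `δ_𝒳(A)` reads `λ^×(ζ_A) ≫ ι_{log,A} = ι_{×,A}`.
[cite: MochizukiAbsTopIII2015, Cor 3.7 (iv) p.88] -/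
theorem logCoreKernel_of_coreFamily (K : 𝔖.logObsDiagram.HomotopyFamily)
    (hcore : ∀ n : ℤ, ∃ h₀ : K.E (corePathPr n) (corePathLog n), IsIso (K.η h₀))
    (hpin : Literature.AnabelianGeometry.AbsoluteAnabelian.AbsTopIII.BiAnabelianSetting.LogPinned 𝔖 K) :
    Literature.AnabelianGeometry.AbsoluteAnabelian.AbsTopIII.BiAnabelianSetting.LogCoreKernel 𝔖 := by
  obtain ⟨h₀, hiso⟩ := hcore 0
  obtain ⟨⟨hT, hhT⟩, hlog⟩ := hpin
  obtain ⟨h₁, hh₁⟩ := hlog 0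
  refine ⟨eqToIso 𝔖.diag_comp_pathFunctor_corePathPr_zero ≪≫
    Functor.isoWhiskerLeft 𝔖.diag (@asIso _ _ _ _ (K.η h₀) hiso) ≪≫
    eqToIso 𝔖.diag_comp_pathFunctor_corePathLog_zero, fun A => ?_⟩
  rw [Iso.trans_hom, Iso.trans_hom, NatTrans.comp_app, NatTrans.comp_app, eqToIso.hom, eqToIso.hom,
    eqToHom_app, eqToHom_app, Functor.isoWhiskerLeft_hom, Functor.whiskerLeft_app, asIso_hom]
  exact K.core_compatible_eq_left (eLog 0) (ePr (0 + 1)) (ePr 0) eLamTimes eLamPf 𝔖.iotaTimes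
    𝔖.iotaLogAt h₀ hT hhT h₁ hh₁ (𝔖.diag.obj A) _ _

/-- **Cor 3.7 (iv), first incompatibility, from the NEGATION of the kernel statement** (every
setting): if there is no natural `ζ : 𝟭 ⥲ log` with `λ^×(ζ) ≫ ι_log = ι_×` (`¬ LogCoreKernel`, F-0388 —
at the MLF model a theorem, `TFModel.modelSetting_not_logCoreKernel`), then `𝒟†_{≤2}` admits no
structure of core on `𝒟†_{≤1}` compatible with `𝔖†_log` as typed (`IncompatibleStmt`, F-0319).  This
sharpens abc-iut-L4-t9's `incompatibleStmt_of_obstruction` (whose hypothesis, the Lemma-3.4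
obstruction, implies `¬ LogCoreKernel` by `not_logCoreKernel_of_logKernelObstruction`).
[cite: MochizukiAbsTopIII2015, Cor 3.7 (iv) p.88] -/
theorem incompatibleStmt_of_not_logCoreKernel
    (h : ¬ Literature.AnabelianGeometry.AbsoluteAnabelian.AbsTopIII.BiAnabelianSetting.LogCoreKernel 𝔖) :
    Literature.AnabelianGeometry.AbsoluteAnabelian.AbsTopIII.BiAnabelianSetting.IncompatibleStmt 𝔖 :=
  fun ⟨K, hcore, hpin⟩ => h (𝔖.logCoreKernel_of_coreFamily K hcore hpin)

/-- Contrapositive: a setting whose `𝒟†_{≤2}` DOES admit a structure of core on `𝒟†_{≤1}` compatible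
with `𝔖†_log` (as typed) satisfies the kernel statement. [cite: MochizukiAbsTopIII2015, Cor 3.7 (iv) p.88] -/
theorem logCoreKernel_of_not_incompatibleStmt
    (h : ¬ Literature.AnabelianGeometry.AbsoluteAnabelian.AbsTopIII.BiAnabelianSetting.IncompatibleStmt 𝔖) :
    Literature.AnabelianGeometry.AbsoluteAnabelian.AbsTopIII.BiAnabelianSetting.LogCoreKernel 𝔖 := by
  by_contra hk
  exact h (𝔖.incompatibleStmt_of_not_logCoreKernel hk)

/-- The Lemma-3.4 route re-derived through the kernel statement: obstruction ⇒ `¬ LogCoreKernel` ⇒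
(iv) (agrees with t9's `incompatibleStmt_of_obstruction`). [cite: MochizukiAbsTopIII2015, Cor 3.7 (iv) p.88] -/
theorem incompatibleStmt_of_obstruction'
    (h : Literature.AnabelianGeometry.AbsoluteAnabelian.AbsTopIII.BiAnabelianSetting.LogKernelObstruction 𝔖) :
    Literature.AnabelianGeometry.AbsoluteAnabelian.AbsTopIII.BiAnabelianSetting.IncompatibleStmt 𝔖 :=
  𝔖.incompatibleStmt_of_not_logCoreKernel (𝔖.not_logCoreKernel_of_logKernelObstruction h)

end BiAnabelianSetting

end AbsTopIII

end Literature.AnabelianGeometry.AbsoluteAnabelian
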